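import Literature.Topology.FourManifolds.SmallSetComplementLoops
import Literature.AlgebraicTopology.FundamentalGroup.VanKampenKernel
import HarnessLib

/-!
# The complement of a closed set of codimension `≥ 3` in a simply connected manifold is
# simply connected

Topic `Literature/Topology/FourManifolds` (fact seat
`provefact-Literature.Topology.FourManifolds.Cobordism.Milnor1965_simplyConnected_plusLevelTwo`;
this file proves, in explicit form, the general-position leaf
`Literature.Topology.FourManifolds.isSimplyConnected_diff_of_subset_iUnion_image` of
`HCobordismLevelSimplyConnected.lean`).  Everything here is **proved**.

**The statement** (`Literature.Topology.FourManifolds.isSimplyConnected_diff_of_smallSet`).  Let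
`M` be a `C¹` manifold modelled on `J : ModelWithCorners ℝ E H` (corners allowed),
`U ⊆ M` open, `S ⊆ U` relatively closed in `U`, consisting of interior points and covered by
countably many `C¹` images `gᵢ(Oᵢ)` of open subsets of a parameter space `P` with
`dim P + 3 ≤ dim E`.  If `U` is simply connected then so is `U ∖ S`.  (General position: a
`2`-disc misses a set of codimension `≥ 3`; Milnor, *Lectures on the h-cobordism theorem*
(1965), Remark 1 after Thm. 6.4, *"this uses `λ ≥ 2`, `n - λ ≥ 3`"*; Hurewicz–Wallman,
*Dimension Theory* (1941), Ch. IV §5 for separation.)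

**Proof.**
* *Locally* (`exists_chartBall`): about an interior point of `U` there is a chart ball
  `N ⊆ U` such that for **every** such small relatively closed `S'`, `N ∖ S'` is nonempty,
  path connected and simply connected — the chart reads `N ∖ S'` as `C ∖ T` for a ball `C`,
  and `Literature.Topology.FourManifolds.SmallSet.isSimplyConnected_diff`
  (`SmallSetComplementLoops.lean`) applies.
* *Connectivity* (`isPathConnected_diff_of_smallSet`): `U ∖ S'` is path connected, by the
  clopen argument of `SmallSetComplement.lean` run inside `U`.
* *van Kampen* (`homotopicWithin_refl_of_union`): for open `A`, `B` with `A`, `A ∩ B` path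
  connected and every loop of `A ∩ B` contractible in `A`, a loop of `A` contractible in
  `A ∪ B` is contractible in `A` — the kernel half of the Seifert–van Kampen theorem
  (`Literature.AlgebraicTopology.FundamentalGroup.VanKampen.fromPath_mem_of_homotopic_refl`,
  Hatcher, Thm. 1.20) with the trivial normal subgroup, after a change of base point.
* *Induction*: a loop `p ⊆ U ∖ S` contracts in `U` through a compact set `K`; cover the
  compact `S ∩ K` by finitely many good balls `B₁, …, Bₘ` and put
  `Y_j = U ∖ (S ∖ (B₁ ∪ ⋯ ∪ B_j))`, so that `Y₀ = U ∖ S`, `K ⊆ Yₘ`, `Y_{j+1} = Y_j ∪ B_{j+1}`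
  and `Y_j ∩ B_{j+1} = B_{j+1} ∖ (…)`; descending along `j` with the van Kampen step, `p`
  contracts in `Y₀`.

## References

* A. Hatcher, *Algebraic Topology* (2002), §1.2, Thm. 1.20. [HatcherAT2002]
* W. Hurewicz, H. Wallman, *Dimension Theory* (1941), Ch. IV §5. [HurewiczWallman1941]
* J. Milnor, *Lectures on the h-cobordism theorem* (1965), Remark 1 after Thm. 6.4 (PDF
  p. 38). [MilnorHCobordism1965]
-/

open scoped Manifold Topology ENNReal unitInterval
open Set Function Filter Metric Module
open Literature.AlgebraicTopology.FundamentalGroup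

noncomputable section

namespace Literature.Topology.FourManifolds

universe u

/-! ### Loops contractible within a subset: lifting, conjugation -/

section Topology

variable {Z : Type*} [TopologicalSpace Z]

/-- A homotopy of lifted paths in the subspace `S` descends to a homotopy within any `S' ⊆ Z`
containing its points. [folklore] -/
theorem homotopicWithin_of_liftPath {S S' : Set Z} {a b : Z} {p q : Path a b}
    (hp : ∀ t, p t ∈ S) (hq : ∀ t, q t ∈ S)
    (h : ∃ F : (VanKampen.liftPath S p hp).Homotopy (VanKampen.liftPath S q hq),
      ∀ x, (F x : Z) ∈ S') :
    VanKampen.HomotopicWithin S' p q := by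
  obtain ⟨F, hF⟩ := h
  refine ⟨{ toFun := fun x => (F x : Z)
            continuous_toFun := continuous_subtype_val.comp F.continuous
            map_zero_left := fun t => ?_
            map_one_left := fun t => ?_
            prop' := fun s t ht => ?_ }, fun x => hF x⟩
  · show (F (0, t) : Z) = p t
    rw [F.apply_zero]; rfl
  · show (F (1, t) : Z) = q t
    rw [F.apply_one]; rfl
  · show (F (s, t) : Z) = p t
    rw [F.eq_fst s ht]; rfl

/-- A homotopy of lifted paths in the subspace `S` is a homotopy within `S`. [folklore] -/
theorem homotopicWithin_iff_liftPath {S : Set Z} {a b : Z} {p q : Path a b}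
    (hp : ∀ t, p t ∈ S) (hq : ∀ t, q t ∈ S) :
    VanKampen.HomotopicWithin S p q ↔
      (VanKampen.liftPath S p hp).Homotopic (VanKampen.liftPath S q hq) := by
  refine ⟨fun h => h.liftPath hp hq, fun ⟨F⟩ => ?_⟩
  exact homotopicWithin_of_liftPath hp hq ⟨F, fun x => (F x).2⟩

/-- `liftPath` of a constant path is the constant path. [folklore] -/
theorem liftPath_refl {S : Set Z} {a : Z} (ha : ∀ t : I, (Path.refl a) t ∈ S) :
    VanKampen.liftPath S (Path.refl a) ha = Path.refl (⟨a, ha 0⟩ : S) := by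
  ext t; rfl

/-- In any space: the conjugate `α · γ · α⁻¹` of a null-homotopic loop is null-homotopic.
[folklore] -/
theorem homotopic_refl_conj {X : Type*} [TopologicalSpace X] {x₀ x : X} (α : Path x₀ x)
    {γ : Path x x} (h : γ.Homotopic (Path.refl x)) :
    ((α.trans γ).trans α.symm).Homotopic (Path.refl x₀) := by
  have h1 : ((α.trans γ).trans α.symm).Homotopic ((α.trans (Path.refl x)).trans α.symm) :=
    Path.Homotopic.hcomp (Path.Homotopic.hcomp (Path.Homotopic.refl α) h) (Path.Homotopic.refl _)
  have h2 : ((α.trans (Path.refl x)).trans α.symm).Homotopic (α.trans α.symm) :=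
    Path.Homotopic.hcomp ⟨Path.Homotopy.transRefl α⟩ (Path.Homotopic.refl _)
  have h3 : (α.trans α.symm).Homotopic (Path.refl x₀) := ⟨(Path.Homotopy.reflTransSymm α).symm⟩
  exact (h1.trans h2).trans h3

/-- In any space: if the conjugate `α · γ · α⁻¹` of a loop `γ` is null-homotopic, so is `γ`
(Hatcher, *Algebraic Topology*, Prop. 1.5). [folklore] -/
theorem homotopic_refl_of_conj {X : Type*} [TopologicalSpace X] {x₀ x : X} (α : Path x₀ x)
    {γ : Path x x} (h : ((α.trans γ).trans α.symm).Homotopic (Path.refl x₀)) :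
    γ.Homotopic (Path.refl x) := by
  rw [← Path.Homotopic.Quotient.eq] at h ⊢
  rw [Path.Homotopic.Quotient.mk_trans, Path.Homotopic.Quotient.mk_trans,
    Path.Homotopic.Quotient.mk_symm, Path.Homotopic.Quotient.mk_refl] at h
  rw [Path.Homotopic.Quotient.mk_refl]
  have h' := congrArg (fun δ => Path.Homotopic.Quotient.trans
    (Path.Homotopic.Quotient.symm (Path.Homotopic.Quotient.mk α))
    (Path.Homotopic.Quotient.trans δ (Path.Homotopic.Quotient.mk α))) h
  simp only [Path.Homotopic.Quotient.trans_assoc, Path.Homotopic.Quotient.symm_trans,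
    Path.Homotopic.Quotient.trans_refl, Path.Homotopic.Quotient.refl_trans] at h'
  rw [← Path.Homotopic.Quotient.trans_assoc, Path.Homotopic.Quotient.symm_trans,
    Path.Homotopic.Quotient.refl_trans] at h'
  exact h'

/-- **Change of base point within a subset**: a loop `γ` at `x` is contractible within `S`
iff its conjugate by a path `α ⊆ S` from `x₀` to `x` is. [folklore] -/
theorem homotopicWithin_refl_conj_iff {S : Set Z} {x₀ x : Z} (α : Path x₀ x)
    (hα : ∀ t, α t ∈ S) (γ : Path x x) (hγ : ∀ t, γ t ∈ S) :
    VanKampen.HomotopicWithin S ((α.trans γ).trans α.symm) (Path.refl x₀) ↔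
      VanKampen.HomotopicWithin S γ (Path.refl x) := by
  have hx₀ : ∀ t : I, (Path.refl x₀) t ∈ S := fun _ => by simpa using hα 0
  have hx : ∀ t : I, (Path.refl x) t ∈ S := fun _ => by simpa using hγ 0
  have hαγ : ∀ t, (α.trans γ) t ∈ S := VanKampen.trans_mem hα hγ
  have hαs : ∀ t, α.symm t ∈ S := VanKampen.symm_mem hα
  have hc : ∀ t, ((α.trans γ).trans α.symm) t ∈ S := VanKampen.trans_mem hαγ hαs
  have hlift : VanKampen.liftPath S ((α.trans γ).trans α.symm) hc =
      ((VanKampen.liftPath S α hα).trans (VanKampen.liftPath S γ hγ)).trans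
        (VanKampen.liftPath S α hα).symm := by
    rw [VanKampen.liftPath_trans S _ _ hαγ hαs, VanKampen.liftPath_trans S _ _ hα hγ,
      VanKampen.liftPath_symm S _ hα]
  rw [homotopicWithin_iff_liftPath hc hx₀, homotopicWithin_iff_liftPath hγ hx, hlift,
    liftPath_refl, liftPath_refl]
  exact ⟨fun h => homotopic_refl_of_conj _ h, fun h => homotopic_refl_conj _ h⟩

/-- The class of a loop is trivial in the fundamental group iff the loop is null-homotopic.
[folklore] -/
theorem fromPath_mk_eq_one_iff {X : Type*} [TopologicalSpace X] {x : X} (δ : Path x x) :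
    FundamentalGroup.fromPath (Path.Homotopic.Quotient.mk δ) = 1 ↔ δ.Homotopic (Path.refl x) := by
  rw [← Path.Homotopic.Quotient.eq, Path.Homotopic.Quotient.mk_refl]
  rfl

/-- **Seifert–van Kampen, kernel form, for loops contractible within subsets** (Hatcher,
*Algebraic Topology*, Thm. 1.20, injectivity half, through the tree's
`VanKampen.fromPath_mem_of_homotopic_refl` with the trivial normal subgroup).  Let `A`, `B`
be open subsets of `Z` with `A` and `A ∩ B` path connected, such that every loop of `A ∩ B` is
contractible within `A`.  Then every loop of `A` which is contractible within `A ∪ B` is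
contractible within `A`. [cite: HatcherAT2002, Thm. 1.20] -/
theorem homotopicWithin_refl_of_union {A B : Set Z} (hA : IsOpen A) (hB : IsOpen B)
    (hApc : IsPathConnected A) (hmeet : IsPathConnected (A ∩ B))
    (hloop : ∀ y (δ : Path y y), (∀ t, δ t ∈ A ∩ B) →
      VanKampen.HomotopicWithin A δ (Path.refl y))
    {x : Z} (γ : Path x x) (hγ : ∀ t, γ t ∈ A)
    (hnull : VanKampen.HomotopicWithin (A ∪ B) γ (Path.refl x)) :
    VanKampen.HomotopicWithin A γ (Path.refl x) := by
  -- a base point in `A ∩ B` and a path in `A` to `x`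
  obtain ⟨x₀, hx₀A, hx₀B⟩ := hmeet.nonempty
  have hxA : x ∈ A := by simpa using hγ 0
  obtain ⟨α, hα⟩ : ∃ α : Path x₀ x, ∀ t, α t ∈ A :=
    ⟨(hApc.joinedIn x₀ hx₀A x hxA).somePath, (hApc.joinedIn x₀ hx₀A x hxA).somePath_mem⟩
  -- the conjugate loop at `x₀`, contractible within `A ∪ B`
  set γ₁ : Path x₀ x₀ := (α.trans γ).trans α.symm with hγ₁def
  have hαγ : ∀ t, (α.trans γ) t ∈ A := VanKampen.trans_mem hα hγ
  have hγ₁ : ∀ t, γ₁ t ∈ A := VanKampen.trans_mem hαγ (VanKampen.symm_mem hα)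
  have hγ₁' : ∀ t, γ₁ t ∈ A ∪ B := fun t => Or.inl (hγ₁ t)
  have hnull₁ : VanKampen.HomotopicWithin (A ∪ B) γ₁ (Path.refl x₀) :=
    (homotopicWithin_refl_conj_iff α (fun t => Or.inl (hα t)) γ fun t => Or.inl (hγ t)).2 hnull
  rw [← homotopicWithin_refl_conj_iff α hα γ hγ]
  -- the space `Y = A ∪ B` and its open cover
  have hx₀' : ∀ t : I, (Path.refl x₀) t ∈ A ∪ B := fun _ => Or.inl hx₀A
  set A' : Set ↥(A ∪ B) := (↑) ⁻¹' A with hA'def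
  set B' : Set ↥(A ∪ B) := (↑) ⁻¹' B with hB'def
  have hA'o : IsOpen A' := hA.preimage continuous_subtype_val
  have hB'o : IsOpen B' := hB.preimage continuous_subtype_val
  have hcov : A' ∪ B' = univ := by
    ext ⟨z, hz⟩
    simpa [hA'def, hB'def] using hz
  have hA'pc : IsPathConnected A' := hApc.preimage_coe subset_union_left
  have hmeet' : IsPathConnected (A' ∩ B') :=
    hmeet.preimage_coe (inter_subset_left.trans subset_union_left)
  set y₀ : ↥(A ∪ B) := ⟨x₀, Or.inl hx₀A⟩ with hy₀def
  -- the conjugate loop, lifted to `Y` and to `A'`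
  set γY : Path y₀ y₀ := VanKampen.liftPath (A ∪ B) γ₁ hγ₁' with hγYdef
  have hγYA : ∀ t, γY t ∈ A' := fun t => hγ₁ t
  set γA : Path (⟨y₀, hx₀A⟩ : A') ⟨y₀, hx₀A⟩ := VanKampen.liftPath A' γY hγYA with hγAdef
  -- it is null-homotopic in `Y`
  have hγYnull : (γA.map continuous_subtype_val).Homotopic (Path.refl y₀) := by
    have h1 : γA.map continuous_subtype_val = γY := by ext t; rfl
    rw [h1, hγYdef, ← liftPath_refl hx₀']
    exact hnull₁.liftPath hγ₁' hx₀'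
  -- the loops of `A'` inside `B'` are trivial in `π₁(A')`
  haveI : (⊥ : Subgroup (FundamentalGroup ↥A' ⟨y₀, hx₀A⟩)).Normal := inferInstance
  have hN : ∀ δ : Path (⟨y₀, hx₀A⟩ : A') ⟨y₀, hx₀A⟩, (∀ t, (δ t : ↥(A ∪ B)) ∈ B') →
      FundamentalGroup.fromPath (Path.Homotopic.Quotient.mk δ) ∈
        (⊥ : Subgroup (FundamentalGroup ↥A' ⟨y₀, hx₀A⟩)) := by
    intro δ hδ
    rw [Subgroup.mem_bot, fromPath_mk_eq_one_iff]
    -- read `δ` in `Z`: a loop at `x₀` inside `A ∩ B`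
    set δZ : Path x₀ x₀ := (δ.map continuous_subtype_val).map continuous_subtype_val with hδZ
    have hδZ_mem : ∀ t, δZ t ∈ A ∩ B := fun t => ⟨(δ t).2, hδ t⟩
    obtain ⟨F, hF⟩ := hloop x₀ δZ hδZ_mem
    refine ⟨{ toFun := fun q => ⟨⟨F q, Or.inl (hF q)⟩, hF q⟩
              continuous_toFun := (F.continuous.subtype_mk _).subtype_mk _
              map_zero_left := fun t => Subtype.ext (Subtype.ext (F.apply_zero t))
              map_one_left := fun t => Subtype.ext (Subtype.ext (F.apply_one t))
              prop' := fun s t ht => Subtype.ext (Subtype.ext (F.eq_fst s ht)) }⟩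
  -- van Kampen
  have hker := VanKampen.fromPath_mem_of_homotopic_refl hA'o hB'o hcov hA'pc hmeet' hx₀A
    (show y₀ ∈ B' from hx₀B) ⊥ hN γA hγYnull
  rw [Subgroup.mem_bot, fromPath_mk_eq_one_iff] at hker
  -- descend to `Z`
  have h2 : VanKampen.HomotopicWithin A' γY (Path.refl y₀) := by
    rw [homotopicWithin_iff_liftPath hγYA fun _ => hx₀A]
    rwa [liftPath_refl]
  exact homotopicWithin_of_liftPath hγ₁' hx₀' ⟨h2.choose, fun q => h2.choose_spec q⟩

end Topology

/-! ### Good chart balls -/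

section Manifold

variable {E : Type*} [NormedAddCommGroup E] [NormedSpace ℝ E] [FiniteDimensional ℝ E]
  {H : Type*} [TopologicalSpace H] {J : ModelWithCorners ℝ E H}
  {M : Type u} [TopologicalSpace M] [ChartedSpace H M] [IsManifold J 1 M]
  {P : Type*} [NormedAddCommGroup P] [NormedSpace ℝ P] [FiniteDimensional ℝ P]

/-- For `U` open and `S` relatively closed in `U`, `U ∖ S` is open. [folklore] -/
theorem isOpen_diff_of_closure_inter_subset {X : Type*} [TopologicalSpace X] {U S : Set X}
    (hU : IsOpen U) (hS : closure S ∩ U ⊆ S) : IsOpen (U \ S) := by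
  have h : U \ S = U \ closure S := by
    refine Subset.antisymm (fun x hx => ⟨hx.1, fun hx' => hx.2 (hS ⟨hx', hx.1⟩)⟩)
      (sdiff_subset_sdiff_right subset_closure)
  rw [h]
  exact hU.sdiff isClosed_closure

/-- **Good chart balls.**  Let the parameter family `gᵢ(Oᵢ)` have `dim P + 3 ≤ dim E`, `U ⊆ M`
open and `x ∈ U` an interior point.  There is an open chart ball `N`, `x ∈ N ⊆ U`, such that
for **every** `S` covered by the family and relatively closed in `U`, the set `N ∖ S` is
nonempty, path connected, and every loop in it contracts inside it (the chart reads `N ∖ S`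
as the complement `C ∖ T` of a small relatively closed set in a ball `C`, where
`SmallSet.isSimplyConnected_diff` applies; `SmallSetComplementLoops.lean`). [folklore] -/
theorem exists_chartBall (hdim : finrank ℝ P + 3 ≤ finrank ℝ E) {ι : Type*} [Countable ι]
    (g : ι → P → M) (O : ι → Set P) (hO : ∀ i, IsOpen (O i))
    (hg : ∀ i, ContMDiffOn 𝓘(ℝ, P) J 1 (g i) (O i)) {U : Set M} (hU : IsOpen U) {x : M}
    (hxU : x ∈ U) (hx : J.IsInteriorPoint x) :
    ∃ N : Set M, IsOpen N ∧ x ∈ N ∧ N ⊆ U ∧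
      ∀ S : Set M, S ⊆ ⋃ i, g i '' O i → closure S ∩ U ⊆ S →
        (N \ S).Nonempty ∧ IsPathConnected (N \ S) ∧
          ∀ y (δ : Path y y), (∀ t, δ t ∈ N \ S) →
            VanKampen.HomotopicWithin (N \ S) δ (Path.refl y) := by
  have hdim2 : finrank ℝ P + 2 ≤ finrank ℝ E := by omega
  set e := extChartAt J x with he
  have h1 : interior e.target ∈ 𝓝 (e x) := isOpen_interior.mem_nhds (J.isInteriorPoint_iff.1 hx)
  have h2 : e.symm ⁻¹' U ∈ 𝓝 (e x) :=
    (continuousAt_extChartAt_symm x).preimage_mem_nhds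
      (by rw [extChartAt_to_inv]; exact hU.mem_nhds hxU)
  obtain ⟨r, hr, hball⟩ : ∃ r > 0, ball (e x) r ⊆ interior e.target ∩ e.symm ⁻¹' U :=
    Metric.mem_nhds_iff.1 (inter_mem h1 h2)
  have htarget : ball (e x) r ⊆ e.target := fun z hz => interior_subset (hball hz).1
  set C : Set E := ball (e x) r with hC
  set N : Set M := e.source ∩ e ⁻¹' C with hN
  have hNU : N ⊆ U := by
    rintro a ⟨ha, haC⟩
    simpa only [mem_preimage, e.left_inv ha] using (hball haC).2
  -- the chart image of a set `S` and its parametrisation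
  set W : ι → Set P := fun i => O i ∩ g i ⁻¹' e.source with hW
  set h : ι → P → E := fun i w => e (g i w) with hh
  have hWo : ∀ i, IsOpen (W i) := fun i =>
    (hg i).continuousOn.isOpen_inter_preimage (hO i) (isOpen_extChartAt_source x)
  have hhd : ∀ i, ContDiffOn ℝ 1 (h i) (W i) := fun i => by
    have h' : ContMDiffOn 𝓘(ℝ, P) 𝓘(ℝ, E) 1 (h i) (W i) := by
      refine (contMDiffOn_extChartAt (n := 1) (x := x)).comp ((hg i).mono inter_subset_left)
        fun w hw => ?_
      rw [← extChartAt_source J]; exact hw.2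
    exact contMDiffOn_iff_contDiffOn.1 h'
  refine ⟨N, isOpen_extChartAt_preimage' x isOpen_ball,
    ⟨mem_extChartAt_source x, mem_ball_self hr⟩, hNU, fun S hS hScl => ?_⟩
  set T : Set E := e.target ∩ e.symm ⁻¹' S with hT
  have hTsub : T ⊆ ⋃ i, h i '' W i := by
    rintro z ⟨hzt, hzS⟩
    obtain ⟨i, hi⟩ := mem_iUnion.1 (hS hzS)
    obtain ⟨w, hw, hwz⟩ := hi
    refine mem_iUnion.2 ⟨i, w, ⟨hw, ?_⟩, ?_⟩
    · show g i w ∈ e.source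
      rw [hwz]; exact e.map_target hzt
    · show e (g i w) = z
      rw [hwz]; exact e.right_inv hzt
  -- `N ∖ S` read in the chart is `C ∖ T`
  have hmemC : ∀ a ∈ N \ S, e a ∈ C \ T := fun a ha =>
    ⟨ha.1.2, fun h' => ha.2 (by simpa only [mem_preimage, e.left_inv ha.1.1] using h'.2)⟩
  have hsymm_mem : ∀ z ∈ C \ T, e.symm z ∈ N \ S := fun z hz =>
    ⟨⟨e.map_target (htarget hz.1), by
        show e (e.symm z) ∈ C
        rw [e.right_inv (htarget hz.1)]; exact hz.1⟩,
      fun hzS => hz.2 ⟨htarget hz.1, hzS⟩⟩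
  have himage : e.symm '' (C \ T) = N \ S := by
    refine Subset.antisymm ?_ fun a ha => ⟨e a, hmemC a ha, e.left_inv ha.1.1⟩
    rintro _ ⟨z, hz, rfl⟩
    exact hsymm_mem z hz
  -- `C ∖ T` is open
  have hCT : IsOpen (C \ T) := by
    have hUS : IsOpen (U \ S) := isOpen_diff_of_closure_inter_subset hU hScl
    have h3 : IsOpen (C ∩ e.symm ⁻¹' (U \ S)) :=
      ((continuousOn_extChartAt_symm x).mono htarget).isOpen_inter_preimage isOpen_ball hUS
    have h4 : C ∩ e.symm ⁻¹' (U \ S) = C \ T := by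
      refine Subset.antisymm (fun z hz => ⟨hz.1, fun hzT => hz.2.2 hzT.2⟩) fun z hz => ⟨hz.1, ?_, ?_⟩
      · exact (hball hz.1).2
      · exact fun hzS => hz.2 ⟨htarget hz.1, hzS⟩
    rw [← h4]; exact h3
  -- the local theorem in the chart
  have hsc : IsSimplyConnected (C \ T) :=
    SmallSet.isSimplyConnected_diff hdim h W hWo hhd hTsub (convex_ball _ _) isOpen_ball
      ⟨e x, mem_ball_self hr⟩ hCT
  have hsymm_cont : ContinuousOn e.symm (C \ T) :=
    (continuousOn_extChartAt_symm x).mono fun z hz => htarget hz.1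
  refine ⟨?_, ?_, fun y δ hδ => ?_⟩
  · obtain ⟨z, hz⟩ := hsc.nonempty
    exact ⟨e.symm z, hsymm_mem z hz⟩
  · rw [← himage]
    exact hsc.isPathConnected.image' hsymm_cont
  · -- read the loop in the chart, contract it there, and come back
    have hy : y ∈ N \ S := by simpa using hδ 0
    have hδsrc : ∀ t, δ t ∈ e.source := fun t => (hδ t).1.1
    let δE : Path (e y) (e y) :=
      { toFun := fun t => e (δ t)
        continuous_toFun := (continuousOn_extChartAt x).comp_continuous δ.continuous hδsrc
        source' := by simp
        target' := by simp }
    have hδE : ∀ t, δE t ∈ C \ T := fun t => hmemC _ (hδ t)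
    obtain ⟨F, hF⟩ := (isSimplyConnected_iff_exists_homotopy_refl_forall_mem.1 hsc).2 (e y) δE hδE
    refine ⟨{ toFun := fun q => e.symm (F q)
              continuous_toFun := hsymm_cont.comp_continuous F.continuous hF
              map_zero_left := fun t => ?_
              map_one_left := fun t => ?_
              prop' := fun s' t ht => ?_ }, fun q => hsymm_mem _ (hF q)⟩
    · show e.symm (F (0, t)) = δ t
      rw [F.apply_zero]
      exact e.left_inv (hδsrc t)
    · show e.symm (F (1, t)) = y
      rw [F.apply_one]
      exact e.left_inv hy.1.1
    · show e.symm (F (s', t)) = δ t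
      rw [F.eq_fst s' ht]
      exact e.left_inv (hδsrc t)

/-! ### The complement of a small relatively closed set in an open path connected set -/

/-- **`U ∖ S` is path connected** for `U` open path connected and `S ⊆ U` relatively closed,
consisting of interior points and covered by the family (`dim P + 3 ≤ dim E`; codimension `2`
would do, cf. `isPathConnected_compl_of_subset_iUnion_image`): the set of points of `U`
whose good ball is joined to a base point inside `U ∖ S` is relatively clopen.
[cite: HurewiczWallman1941, Ch. IV §5, Thm. IV 4 and Cor. 1] -/
theorem isPathConnected_diff_of_smallSet (hdim : finrank ℝ P + 3 ≤ finrank ℝ E)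
    {ι : Type*} [Countable ι] (g : ι → P → M) (O : ι → Set P) (hO : ∀ i, IsOpen (O i))
    (hg : ∀ i, ContMDiffOn 𝓘(ℝ, P) J 1 (g i) (O i)) {U S : Set M} (hU : IsOpen U)
    (hUpc : IsPathConnected U) (hScl : closure S ∩ U ⊆ S)
    (hSint : ∀ x ∈ S, J.IsInteriorPoint x) (hS : S ⊆ ⋃ i, g i '' O i) :
    IsPathConnected (U \ S) := by
  have hdim2 : finrank ℝ P + 2 ≤ finrank ℝ E := by omega
  have hint : interior S = ∅ := interior_eq_empty_of_subset_iUnion_image hdim2 hSint g O hO hg hS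
  have hUS : IsOpen (U \ S) := isOpen_diff_of_closure_inter_subset hU hScl
  -- good neighbourhoods about every point of `U`
  have key : ∀ x, ∃ N : Set M, x ∈ U → IsOpen N ∧ x ∈ N ∧ N ⊆ U ∧ (N \ S).Nonempty ∧
      ∀ a ∈ N \ S, ∀ b ∈ N \ S, JoinedIn (U \ S) a b := by
    intro x
    by_cases hxU : x ∈ U
    · by_cases hxS : x ∈ S
      · obtain ⟨N, hNo, hxN, hNU, hN⟩ := exists_chartBall hdim g O hO hg hU hxU (hSint x hxS)
        obtain ⟨hne, hpc, -⟩ := hN S hS hScl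
        exact ⟨N, fun _ => ⟨hNo, hxN, hNU, hne, fun a ha b hb =>
          (hpc.joinedIn a ha b hb).mono (sdiff_subset_sdiff_left hNU)⟩⟩
      · obtain ⟨N, hNo, hxN, hNW, hNpc⟩ :=
          exists_isOpen_isPathConnected_subset J hUS (x := x) ⟨hxU, hxS⟩
        refine ⟨N, fun _ => ⟨hNo, hxN, hNW.trans sdiff_subset, ⟨x, hxN, fun h => (hNW hxN).2 h⟩,
          fun a ha b hb => (hNpc.joinedIn a ha.1 b hb.1).mono ?_⟩⟩
        exact fun z hz => hNW hz
    · exact ⟨∅, fun h => (hxU h).elim⟩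
  choose N hN using key
  -- nonempty open sets meet `Sᶜ`
  have hmeet : ∀ V : Set M, IsOpen V → V.Nonempty → (V \ S).Nonempty := by
    intro V hV hVne
    by_contra hc
    have hsub : V ⊆ S := fun z hz => by_contra fun hzS => hc ⟨z, hz, hzS⟩
    have : V ⊆ interior S := interior_maximal hsub hV
    rw [hint] at this
    exact hVne.ne_empty (subset_empty_iff.1 this)
  -- a base point
  obtain ⟨u₀, hu₀⟩ := hUpc.nonempty
  obtain ⟨b₀, hb₀⟩ := (hN u₀ hu₀).2.2.2.1
  have hb₀US : b₀ ∈ U \ S := ⟨(hN u₀ hu₀).2.2.1 hb₀.1, hb₀.2⟩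
  -- `Q`: the points of `U` whose good ball is joined to `b₀`
  set Q : Set M := {y | y ∈ U ∧ ∃ a ∈ N y \ S, JoinedIn (U \ S) b₀ a} with hQ
  -- two points sharing a good ball are simultaneously in `Q`
  have hshare : ∀ y ∈ U, ∀ y' ∈ U, y' ∈ N y → y ∈ Q → y' ∈ Q := by
    rintro y hy y' hy' hy'N ⟨-, a, ha, hba⟩
    obtain ⟨a', ha'⟩ := hmeet (N y ∩ N y') ((hN y hy).1.inter (hN y' hy').1)
      ⟨y', hy'N, (hN y' hy').2.1⟩
    have h1 : JoinedIn (U \ S) a a' := (hN y hy).2.2.2.2 a ha a' ⟨ha'.1.1, ha'.2⟩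
    exact ⟨hy', a', ⟨ha'.1.2, ha'.2⟩, hba.trans h1⟩
  have hshare' : ∀ y ∈ U, ∀ y' ∈ U, y' ∈ N y → y' ∈ Q → y ∈ Q := by
    rintro y hy y' hy' hy'N ⟨-, a, ha, hba⟩
    obtain ⟨a', ha'⟩ := hmeet (N y ∩ N y') ((hN y hy).1.inter (hN y' hy').1)
      ⟨y', hy'N, (hN y' hy').2.1⟩
    have h1 : JoinedIn (U \ S) a a' := (hN y' hy').2.2.2.2 a ha a' ⟨ha'.1.2, ha'.2⟩
    exact ⟨hy, a', ⟨ha'.1.1, ha'.2⟩, hba.trans h1⟩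
  -- `b₀ ∈ Q`
  have hb₀U : b₀ ∈ U := hb₀US.1
  have hb₀Q : b₀ ∈ Q := by
    obtain ⟨a, ha⟩ := (hN b₀ hb₀U).2.2.2.1
    exact ⟨hb₀U, a, ha, (hN b₀ hb₀U).2.2.2.2 b₀ ⟨(hN b₀ hb₀U).2.1, hb₀US.2⟩ a ha⟩
  -- every point of `U` is in `Q`
  have hall : ∀ y ∈ U, y ∈ Q := by
    by_contra hc
    push Not at hc
    obtain ⟨y₁, hy₁U, hy₁Q⟩ := hc
    set V₁ : Set M := ⋃ y ∈ {y | y ∈ U ∧ y ∈ Q}, N y with hV₁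
    set V₂ : Set M := ⋃ y ∈ {y | y ∈ U ∧ y ∉ Q}, N y with hV₂
    have hV₁o : IsOpen V₁ := isOpen_biUnion fun y hy => (hN y hy.1).1
    have hV₂o : IsOpen V₂ := isOpen_biUnion fun y hy => (hN y hy.1).1
    have hcov : U ⊆ V₁ ∪ V₂ := fun y hy => by
      by_cases hyQ : y ∈ Q
      · exact Or.inl (mem_biUnion (show y ∈ {y | y ∈ U ∧ y ∈ Q} from ⟨hy, hyQ⟩) (hN y hy).2.1)
      · exact Or.inr (mem_biUnion (show y ∈ {y | y ∈ U ∧ y ∉ Q} from ⟨hy, hyQ⟩) (hN y hy).2.1)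
    have hpre : IsPreconnected U := hUpc.isConnected.isPreconnected
    obtain ⟨w, hwU, hw₁, hw₂⟩ := hpre V₁ V₂ hV₁o hV₂o hcov
      ⟨b₀, hb₀U, mem_biUnion (show b₀ ∈ {y | y ∈ U ∧ y ∈ Q} from ⟨hb₀U, hb₀Q⟩) (hN b₀ hb₀U).2.1⟩
      ⟨y₁, hy₁U, mem_biUnion (show y₁ ∈ {y | y ∈ U ∧ y ∉ Q} from ⟨hy₁U, hy₁Q⟩) (hN y₁ hy₁U).2.1⟩
    rw [hV₁, mem_iUnion₂] at hw₁
    rw [hV₂, mem_iUnion₂] at hw₂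
    obtain ⟨x₁, ⟨hx₁U, hx₁Q⟩, hwx₁⟩ := hw₁
    obtain ⟨x₂, ⟨hx₂U, hx₂Q⟩, hwx₂⟩ := hw₂
    exact hx₂Q (hshare' x₂ hx₂U w hwU hwx₂ (hshare x₁ hx₁U w hwU hwx₁ hx₁Q))
  -- conclusion
  refine ⟨b₀, hb₀US, fun y hy => ?_⟩
  obtain ⟨-, a, ha, hba⟩ := hall y hy.1
  exact hba.trans ((hN y hy.1).2.2.2.2 a ha y ⟨(hN y hy.1).2.1, hy.2⟩)

/-! ### The theorem -/

/-- **The complement of a closed set of codimension `≥ 3` in a simply connected open set of a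
manifold is simply connected** (general position; Milnor 1965, Remark 1 after Thm. 6.4:
*"this uses `λ ≥ 2`, `n - λ ≥ 3`"*).  Let `M` be a `C¹` manifold with corners, `U ⊆ M` open
and simply connected, `S ⊆ U` relatively closed in `U`, consisting of interior points and
covered by countably many `C¹` images of open subsets of `P`, `dim P + 3 ≤ dim E`.  Then
`U ∖ S` is simply connected.  Proof: a loop of `U ∖ S` contracts in `U` through a compact
set `K`; finitely many good chart balls `B₁, …, Bₘ` (`exists_chartBall`) cover `S ∩ K`, and
descending along `Y_j = U ∖ (S ∖ (B₁ ∪ ⋯ ∪ B_j))` with the kernel half of van Kampen's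
theorem (`homotopicWithin_refl_of_union`; the pieces `Y_j`, `Y_j ∩ B_{j+1} = B_{j+1} ∖ …` are
path connected by `isPathConnected_diff_of_smallSet` and the loops of the latter contract in
it) the loop contracts in `Y₀ = U ∖ S`. [folklore] -/
theorem isSimplyConnected_diff_of_smallSet (hdim : finrank ℝ P + 3 ≤ finrank ℝ E)
    {ι : Type*} [Countable ι] (g : ι → P → M) (O : ι → Set P) (hO : ∀ i, IsOpen (O i))
    (hg : ∀ i, ContMDiffOn 𝓘(ℝ, P) J 1 (g i) (O i)) {U S : Set M} (hU : IsOpen U)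
    (hSU : S ⊆ U) (hScl : closure S ∩ U ⊆ S) (hSint : ∀ x ∈ S, J.IsInteriorPoint x)
    (hS : S ⊆ ⋃ i, g i '' O i) (hUsc : IsSimplyConnected U) : IsSimplyConnected (U \ S) := by
  classical
  rw [isSimplyConnected_iff_exists_homotopy_refl_forall_mem]
  refine ⟨isPathConnected_diff_of_smallSet hdim g O hO hg hU hUsc.isPathConnected hScl hSint hS,
    fun x p hp => ?_⟩
  change VanKampen.HomotopicWithin (U \ S) p (Path.refl x)
  -- contract `p` in `U`
  obtain ⟨F₀, hF₀⟩ := (isSimplyConnected_iff_exists_homotopy_refl_forall_mem.1 hUsc).2 x p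
    fun t => (hp t).1
  set K : Set M := range F₀ with hK
  have hKc : IsCompact K := isCompact_range F₀.continuous
  have hKU : K ⊆ U := by rintro _ ⟨q, rfl⟩; exact hF₀ q
  -- the compact set `S ∩ K`
  set SK : Set M := K ∩ closure S with hSK
  have hSKc : IsCompact SK := hKc.inter_right isClosed_closure
  have hSKS : SK ⊆ S := fun z hz => hScl ⟨hz.2, hKU hz.1⟩
  -- good balls about the points of `S`, and a finite subcover of `S ∩ K`
  have hballs : ∀ y : ↥SK, ∃ B : Set M, IsOpen B ∧ (y : M) ∈ B ∧ B ⊆ U ∧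
      ∀ S' : Set M, S' ⊆ ⋃ i, g i '' O i → closure S' ∩ U ⊆ S' →
        (B \ S').Nonempty ∧ IsPathConnected (B \ S') ∧
          ∀ z (δ : Path z z), (∀ t, δ t ∈ B \ S') →
            VanKampen.HomotopicWithin (B \ S') δ (Path.refl z) := fun y =>
    exists_chartBall hdim g O hO hg hU (hSU (hSKS y.2)) (hSint _ (hSKS y.2))
  choose B hBo hyB hBU hB using hballs
  obtain ⟨t₀, ht₀⟩ := hSKc.elim_finite_subcover B hBo fun y hy => mem_iUnion.2 ⟨⟨y, hy⟩, hyB _⟩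
  -- the sets `S ∖ ⋃_{i ∈ t} B i` are again small and relatively closed
  have hsmall : ∀ t : Finset ↥SK, (S \ ⋃ i ∈ t, B i) ⊆ ⋃ i, g i '' O i := fun t =>
    sdiff_subset.trans hS
  have hrel : ∀ t : Finset ↥SK, closure (S \ ⋃ i ∈ t, B i) ∩ U ⊆ S \ ⋃ i ∈ t, B i := by
    intro t z hz
    refine ⟨hScl ⟨closure_mono sdiff_subset hz.1, hz.2⟩, fun hzB => ?_⟩
    obtain ⟨i, hi, hzi⟩ := mem_iUnion₂.1 hzB
    have hnhds : B i ∈ 𝓝 z := (hBo i).mem_nhds hzi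
    obtain ⟨w, hwB, hw⟩ := mem_closure_iff_nhds.1 hz.1 (B i) hnhds
    exact hw.2 (mem_iUnion₂.2 ⟨i, hi, hwB⟩)
  -- descending induction over the finite subcover
  suffices hind : ∀ t : Finset ↥SK,
      VanKampen.HomotopicWithin (U \ (S \ ⋃ i ∈ t, B i)) p (Path.refl x) →
        VanKampen.HomotopicWithin (U \ S) p (Path.refl x) by
    refine hind t₀ ⟨F₀, fun q => ⟨hF₀ q, fun hq => hq.2 ?_⟩⟩
    exact ht₀ ⟨mem_range_self q, subset_closure hq.1⟩
  intro t
  induction t using Finset.induction_on with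
  | empty => intro h; simpa using h
  | insert i t hit ih =>
    intro h
    apply ih
    -- the van Kampen step: `A = U ∖ (S ∖ ⋃_t B)`, `A ∪ B i = U ∖ (S ∖ ⋃_{insert i t} B)`
    set S' : Set M := S \ ⋃ j ∈ t, B j with hS'
    set A : Set M := U \ S' with hA
    have hAo : IsOpen A := isOpen_diff_of_closure_inter_subset hU (hrel t)
    have hApc : IsPathConnected A :=
      isPathConnected_diff_of_smallSet hdim g O hO hg hU hUsc.isPathConnected (hrel t)
        (fun z hz => hSint z hz.1) (hsmall t)
    have hAB : A ∩ B i = B i \ S' := by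
      ext z
      simp only [hA, mem_inter_iff, Set.mem_sdiff]
      constructor
      · rintro ⟨⟨-, hzS'⟩, hzB⟩; exact ⟨hzB, hzS'⟩
      · rintro ⟨hzB, hzS'⟩; exact ⟨⟨hBU i hzB, hzS'⟩, hzB⟩
    obtain ⟨-, hBpc, hBloop⟩ := hB i S' (hsmall t) (hrel t)
    have hmeet : IsPathConnected (A ∩ B i) := by rw [hAB]; exact hBpc
    have hloop : ∀ y (δ : Path y y), (∀ s, δ s ∈ A ∩ B i) →
        VanKampen.HomotopicWithin A δ (Path.refl y) := by
      intro y δ hδ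
      rw [hAB] at hδ
      obtain ⟨G, hG⟩ := hBloop y δ hδ
      exact ⟨G, fun q => by rw [← hAB] at hG; exact (hG q).1⟩
    have hunion : A ∪ B i = U \ (S \ ⋃ j ∈ insert i t, B j) := by
      ext z
      simp only [hA, hS', Finset.set_biUnion_insert, mem_union, Set.mem_sdiff, mem_iUnion, not_and,
        not_exists, exists_prop, not_forall, not_not]
      constructor
      · rintro (⟨hzU, hz⟩ | hzB)
        · exact ⟨hzU, fun hzS => Or.inr (by simpa using hz hzS)⟩
        · exact ⟨hBU i hzB, fun _ => Or.inl hzB⟩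
      · rintro ⟨hzU, hz⟩
        by_cases hzB : z ∈ B i
        · exact Or.inr hzB
        · refine Or.inl ⟨hzU, fun hzS => ?_⟩
          rcases hz hzS with h' | h'
          · exact absurd h' hzB
          · simpa using h'
    have hpA : ∀ s, p s ∈ A := fun s => ⟨(hp s).1, fun h' => (hp s).2 h'.1⟩
    rw [← hunion] at h
    exact homotopicWithin_refl_of_union hAo (hBo i) hApc hmeet hloop p hpA h

end Manifold

end Literature.Topology.FourManifolds
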